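import Literature.AlgebraicGeometry.Hu2025.Statements.S01S09Interface.R110eGammaOfMatroid
import HarnessLib

/-!
# [Hu22] p.131 (proof of Thm 9.5): the setting (9.2)/(9.3) and the sentence P131L40 — OURS SIBLING separating «density of
# `Gr_d` in `Z_Γ`» from «integrality of `Gr_d`» — row 110 file `f` (= e′) = `S01S09Interface/R110fSetupOurs.lean`,
# STATEMENTS-FIRST (rung M-Hu-min, D-0089). Requested by the M-Hu lead res-adj-8 (HOME INBOX 2026-08-27T07:24:58Z: «BOTH
# ((i) + (ii)) as a SEPARATE OURS sibling — keep file e AS DEPOSITED»). res-type-024 gen 11.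

**Status of the sources (D-0012): UNREFEREED PREPRINTS UNDER ADJUDICATION.** [Hu22] = Y. Hu, arXiv:2203.03842v4 (2022),
p.131; [Hu25] = arXiv:2507.21400v1, Prop. 9.1 (chunk p0072 l.71–82). File e types the PRINTED data literally
(`Hu22Setup`, `Hu22P131L40`); as disclosed there and in the typer note 07:24:34Z, nothing printed ties the field `cell` to
Lafforgue's thin Schubert cell, and the conclusion of `Hu22P131L40` does not depend on the inhabitant. THIS FILE adds,
labelled OURS (reading: OURS — separation of density from integrality):
* `Hu22Setup_ours` = `Hu22Setup` + (i) the Prop.-9.1 identification of the IMAGE of `Gr_d ↪ Z_Γ`: the open locus of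
  `Z_Γ = Spec 𝔽[x_u]/I_{℘,Γ_d}` where every coordinate `x̄_u`, `u ∉ Γ_d`, is invertible ([Hu22] p.131 l.27–28 «We can apply
  Proposition 9.1 to the matroid Schubert cell»; [Hu25] Prop. 9.1: `Gr_d = {p_u = 0 (x_u ∉ Δ_d), p_u ≠ 0 (x_u ∈ Δ_d)}`, in the
  chart `p_(123) ≠ 0` with `x_u = p_u/p_(123)`);
* `Hu22P131L40_ours S` = the printed one-step sentence read as two steps: (a) `X` integral ⇒ `Gr_d` integral (NOT typed —
  (ii) enters as the antecedent `IsIntegral S.cell`) and (b) `Gr_d` integral ∧ `Gr_d ↪ Z_Γ` open with the Prop.-9.1 image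
  ⇒ `Z_Γ` integral — (b) is the statement.
Every decl is a candidate / structure tagged `[claim: Hu2022, status: under-review]`, consumed only as a hypothesis, never
asserted; no proofs, no `sorry`, no `instance`, no notation. EXISTENCE of an inhabitant is NOT shown. AI typing is weaker
than expert review. STATUS: candidate statements under adjudication (D-0012/D-0089); not asserted.
-/

noncomputable section

open _root_.CategoryTheory _root_.AlgebraicGeometry

namespace Literature.AlgebraicGeometry.Hu2025.Statements.S01S09Interface

open Literature.AlgebraicGeometry.Hu2025.Statements.S08MainTheorem
open Literature.AlgebraicGeometry.Hu2025.Statements.S07GammaSchemes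
open Literature.AlgebraicGeometry.Hu2025.Statements.S03Pluecker

/-- **[Hu22] p.131 setting (9.2)/(9.3) with the Prop.-9.1 identification EXPLICIT — OURS sibling of `Hu22Setup`**
([Hu22] p.131 l.4–41; the added field reads l.27–28 «We can apply Proposition 9.1 to the matroid Schubert cell `Gr^{3,E}_d`»
with [Hu25] Prop. 9.1, chunk p0072 l.71–82): the printed data of `Hu22Setup` plus `range_cellToGamma` — the image of the
open immersion `cell ↪ Z_Γ` is `{x ∈ Spec 𝔽[x_u]/I_{℘,Γ_d} ∣ x̄_u ∉ 𝔭_x for every u ∉ Γ_d}` (the thin Schubert cell inside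
`Z_Γ ⊂ 𝐔_m`). Rules out inhabitants whose `cell` is not the cell. Labelled OURS (reading: OURS — separation of density from
integrality; requested by the M-Hu lead 2026-08-27T07:24:58Z); the literal record is `Hu22Setup`. EXISTENCE NOT SHOWN here.
[claim: Hu2022, status: under-review]
STATUS: candidate statement under adjudication (D-0012/D-0089); not asserted. -/
structure Hu22Setup_ours (𝔽 : Type) [Field 𝔽] (n : ℕ) (M : HuMatroid n 3) extends Hu22Setup 𝔽 n M where
  /-- (i) Prop. 9.1 in the chart `𝐔_m`: the image of `Gr_d` in `Z_Γ` is `{x ∣ x̄_u ∉ 𝔭_x for all u ∉ Γ_d}` -/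
  range_cellToGamma : Set.range cellToGamma.base =
    {x : PrimeSpectrum (GammaSchemeRing (primaryFamily n 𝔽) (GammaOfMatroidVar M)) |
      ∀ u : plVar n, u ∉ GammaOfMatroidVar M →
        (Ideal.Quotient.mk (gammaWpIdeal (primaryFamily n 𝔽) (GammaOfMatroidVar M)) (MvPolynomial.X u)) ∉ x.asIdeal}

/-- **[Hu22] p.131 l.40–41 «As `X` is integral (by assumption), one sees that `Z_Γ` is integral» — OURS two-step reading
over `Hu22Setup_ours`**: with (ii) «`Gr_d` is integral» as an explicit antecedent (the untyped step (a) `X` integral ⇒ `U`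
integral ⇒ `Gr_d` integral via the torus quotient of Thm 9.4), the decl states step (b): `X` integral → `cell` integral →
`Z_Γ = gammaSpec (primaryFamily n 𝔽) (Γ_d ∩ Var_𝐔)` integral, where `cell ↪ Z_Γ` is open with the Prop.-9.1 image
(`range_cellToGamma`). Its adjudicable content is the DENSITY of that image in `Z_Γ`. Labelled OURS (reading: OURS —
separation of density from integrality; requested by the M-Hu lead 2026-08-27T07:24:58Z); the printed one-step sentence is
`Hu22P131L40`. No side is taken (tree index only: `Literature/AlgebraicGeometry/Hu2025/GammaSchemeNotIntegral*.lean`).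
[claim: Hu2022, status: under-review]
STATUS: candidate statement under adjudication (D-0012/D-0089); not asserted. -/
def Hu22P131L40_ours {𝔽 : Type} [Field 𝔽] {n : ℕ} {M : HuMatroid n 3} (S : Hu22Setup_ours 𝔽 n M) : Prop :=
  IsIntegral S.X → IsIntegral S.cell →
    IsIntegral (gammaSpec (primaryFamily n 𝔽) (GammaOfMatroidVar M))

end Literature.AlgebraicGeometry.Hu2025.Statements.S01S09Interface

end
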